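import Literature.Analysis.FluidPDE.NSSliceTimePairing
import HarnessLib

/-!
# Time increments of the pairings of a bounded distributional Navier–Stokes solution

Support file for the discharge of `Literature.Analysis.FluidPDE.NSSliceTimeContinuity`
(`FluidPDE/NSBoundedInteriorRegularity`), continuing `FluidPDE/NSSliceTimePairing`. For a
distributional solution `(u, p)` in the centred cylinder `Q*_R(z) = I × B`, bounded a.e. by
`M`, with `p ∈ L¹(Q*_R(z))`, and a test field `η` on `B` with `‖Dη‖ ≤ K₁`, `‖Δη‖ ≤ K₂`:

* `exists_ae_pairing_eq_const_add_primitive` — `g_η(t) = ∫_B ⟪u(t), η⟫ = c + ∫_{]a,t]} f_η`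
  for a.e. `t ∈ I = ]a, b[`, `a = t₀ - R²`;
* `ae_abs_remainder_le` — `|f_η(t)| ≤ A₀ + 3 K₁ ∫_B |p(t)|` for a.e. `t ∈ I`, with
  `A₀ = |B| (K₁ M² + K₂ M)`;
* `abs_primitive_sub_primitive_le` — hence
  `|∫_{]a,t]} f_η - ∫_{]a,t']} f_η| ≤ A |P(t) - P(t')|` on `[a, b]` with the **pressure clock**
  `P(t) = ∫_{]a,t]} (1 + ∫_B |p|)`, a continuous nondecreasing function of `t` independent of `η`,
  and `A = |A₀| + 3 |K₁|`;
* `continuousOn_pressureClock` — continuity of `P` on `[a, b]`.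

Folklore bookkeeping (Robinson–Rodrigo–Sadowski 2016, §13.5, Lemma 13.8 is the model:
`‖g(t₂) - g(t₁)‖ ≤ ∫_{t₁}^{t₂} ‖∂ₜg‖`).

## References

* J. C. Robinson, J. L. Rodrigo, W. Sadowski, *The three-dimensional Navier–Stokes equations*
  (CUP 2016), §13.5, Lemma 13.8. [`RobinsonRodrigoSadowskiCUP2016`]
-/

noncomputable section

open MeasureTheory Set Function Filter Topology TopologicalSpace Metric intervalIntegral
open scoped NNReal ENNReal InnerProductSpace RealInnerProductSpace Laplacian

namespace Literature.Analysis.FluidPDE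

/-- Local notation for physical space `ℝ³ = EuclideanSpace ℝ (Fin 3)`. -/
local notation "ℝ³" => EuclideanSpace ℝ (Fin 3)

variable {u : ℝ → ℝ³ → ℝ³} {p : ℝ → ℝ³ → ℝ} {z : ℝ × ℝ³} {R M : ℝ}

/-! ### The a.e. primitive representation of the pairing -/

/-- **The pairing is a primitive, a.e.** For a distributional solution in `Q*_R(z) = I × B`,
bounded a.e. by `M`, with integrable pressure, and a test field `η` on `B`: for some constant `c`
and a.e. `t ∈ I`, `∫_B ⟪u(t), η⟫ = c + ∫_{]a,t]} ∫_B (⟪u, Dη u⟫ + ⟪u, Δη⟫ + p div η)`,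
`a = t₀ - R²` (`setIntegral_deriv_mul_pairing_add_eq_zero` and du Bois-Reymond,
`exists_ae_eq_const_add_primitive`). [folklore] -/
theorem exists_ae_pairing_eq_const_add_primitive
    (hsol : IsDistributionalNSSolutionOn (parabolicCylinderCenteredOpens R z) 1 0 u p)
    (hbd : ∀ᵐ w ∂(volume.restrict (parabolicCylinderCentered R z)), ‖u w.1 w.2‖ ≤ M)
    (hpi : IntegrableOn (uncurry p) (parabolicCylinderCentered R z) volume)
    {η : ℝ³ → ℝ³} (hη : FunctionSpaces.IsTestFunctionOn ⟨ball z.2 R, isOpen_ball⟩ η) :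
    ∃ c : ℝ, ∀ᵐ t ∂(volume.restrict (Ioo (z.1 - R ^ 2) (z.1 + R ^ 2))),
      (∫ x in ball z.2 R, ⟪u t x, η x⟫) = c + ∫ s in Ioc (z.1 - R ^ 2) t,
        ∫ x in ball z.2 R, (⟪u s x, fderiv ℝ η x (u s x)⟫ + ⟪u s x, Δ η x⟫ +
          p s x * VectorCalculus.divergence η x) := by
  obtain ⟨K₀, K₁, K₂, hK₀, hK₁, hK₂⟩ := exists_bounds_of_isTestFunctionOn hη
  have hη2 : ContDiff ℝ 2 η := hη.contDiff.of_le (by norm_cast)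
  have iU := integrable_inner_test hsol hbd hη.contDiff.continuous hK₀
  have iG := integrable_remainder_test hsol hbd hpi hη2 hK₁ hK₂
  rw [volume_restrict_parabolicCylinderCentered] at iU iG
  refine exists_ae_eq_const_add_primitive iU.integral_prod_left iG.integral_prod_left
    fun χ hχ hχc hχI => ?_
  exact setIntegral_deriv_mul_pairing_add_eq_zero hsol hbd hpi hχ hχc hχI hη

/-! ### Bounding the remainder by the pressure -/

/-- `|div η| ≤ 3 ‖Dη‖ ≤ 3 K₁` in dimension three (trace against an orthonormal basis). [folklore] -/
theorem norm_divergence_le_three_mul {η : ℝ³ → ℝ³} {K₁ : ℝ} (hK₁ : ∀ x, ‖fderiv ℝ η x‖ ≤ K₁)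
    (x : ℝ³) : ‖VectorCalculus.divergence η x‖ ≤ 3 * K₁ := by
  set b := EuclideanSpace.basisFun (Fin 3) ℝ
  rw [divergence_eq_sum_inner_fderiv b η x, Real.norm_eq_abs]
  calc |∑ i, ⟪b i, fderiv ℝ η x (b i)⟫|
      ≤ ∑ i, |⟪b i, fderiv ℝ η x (b i)⟫| := Finset.abs_sum_le_sum_abs _ _
    _ ≤ ∑ _i : Fin 3, K₁ := Finset.sum_le_sum fun i _ => ?_
    _ = 3 * K₁ := by simp
  calc |⟪b i, fderiv ℝ η x (b i)⟫| ≤ ‖b i‖ * ‖fderiv ℝ η x (b i)‖ := abs_real_inner_le_norm _ _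
    _ ≤ 1 * (‖fderiv ℝ η x‖ * 1) := by
        rw [b.norm_eq_one i]
        gcongr
        simpa [b.norm_eq_one i] using (fderiv ℝ η x).le_opNorm (b i)
    _ ≤ K₁ := by simpa using hK₁ x

/-- For a.e. `t` of the time window, the slice `u(t, ·)` is bounded by `M` a.e. on the ball.
[folklore] -/
theorem ae_ae_norm_slice_le
    (hbd : ∀ᵐ w ∂(volume.restrict (parabolicCylinderCentered R z)), ‖u w.1 w.2‖ ≤ M) :
    ∀ᵐ t ∂(volume.restrict (Ioo (z.1 - R ^ 2) (z.1 + R ^ 2))),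
      ∀ᵐ x ∂(volume.restrict (ball z.2 R)), ‖u t x‖ ≤ M := by
  rw [volume_restrict_parabolicCylinderCentered] at hbd
  exact Measure.ae_ae_of_ae_prod hbd

/-- For a.e. `t` of the time window, the pressure slice is integrable on the ball and the
remainder `f_η(t) = ∫_B (⟪u, Dη u⟫ + ⟪u, Δη⟫ + p div η)(t)` is bounded by
`|B| (K₁ M² + K₂ M) + 3 K₁ ∫_B |p(t)|`. [folklore] -/
theorem ae_abs_remainder_le
    (hsol : IsDistributionalNSSolutionOn (parabolicCylinderCenteredOpens R z) 1 0 u p)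
    (hbd : ∀ᵐ w ∂(volume.restrict (parabolicCylinderCentered R z)), ‖u w.1 w.2‖ ≤ M)
    (hpi : IntegrableOn (uncurry p) (parabolicCylinderCentered R z) volume)
    {η : ℝ³ → ℝ³} (hη2 : ContDiff ℝ 2 η) {K₁ K₂ : ℝ} (hK₁ : ∀ x, ‖fderiv ℝ η x‖ ≤ K₁)
    (hK₂ : ∀ x, ‖Δ η x‖ ≤ K₂) :
    ∀ᵐ t ∂(volume.restrict (Ioo (z.1 - R ^ 2) (z.1 + R ^ 2))),
      |∫ x in ball z.2 R, (⟪u t x, fderiv ℝ η x (u t x)⟫ + ⟪u t x, Δ η x⟫ +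
          p t x * VectorCalculus.divergence η x)| ≤
        (volume (ball z.2 R)).toReal * (K₁ * M ^ 2 + K₂ * M) +
          3 * K₁ * ∫ x in ball z.2 R, |p t x| := by
  have hu := integrableOn_of_ae_bound hsol hbd
  have hdivb : ∀ x, ‖VectorCalculus.divergence η x‖ ≤ 3 * K₁ :=
    norm_divergence_le_three_mul hK₁
  rw [IntegrableOn, volume_restrict_parabolicCylinderCentered] at hu hpi
  filter_upwards [ae_ae_norm_slice_le hbd, hu.prod_right_ae, hpi.prod_right_ae] with t hbt hut hpt
  have hpt' : Integrable (fun x => p t x) (volume.restrict (ball z.2 R)) := hpt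
  have hut' : Integrable (fun x => u t x) (volume.restrict (ball z.2 R)) := hut
  -- pointwise bounds, a.e. on the ball
  have h1 : ∀ᵐ x ∂(volume.restrict (ball z.2 R)),
      ‖⟪u t x, fderiv ℝ η x (u t x)⟫ + ⟪u t x, Δ η x⟫‖ ≤ K₁ * M ^ 2 + K₂ * M := by
    filter_upwards [hbt] with x hx
    have hK₁0 : 0 ≤ K₁ := (norm_nonneg _).trans (hK₁ x)
    have hK₂0 : 0 ≤ K₂ := (norm_nonneg _).trans (hK₂ x)
    refine (norm_add_le _ _).trans (add_le_add ?_ ?_)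
    · calc ‖⟪u t x, fderiv ℝ η x (u t x)⟫‖ ≤ ‖u t x‖ * ‖fderiv ℝ η x (u t x)‖ :=
            norm_inner_le_norm _ _
        _ ≤ ‖u t x‖ * (K₁ * ‖u t x‖) := by
            gcongr
            exact (ContinuousLinearMap.le_opNorm _ _).trans
              (mul_le_mul_of_nonneg_right (hK₁ x) (norm_nonneg _))
        _ = K₁ * ‖u t x‖ ^ 2 := by ring
        _ ≤ K₁ * M ^ 2 := by gcongr
    · calc ‖⟪u t x, Δ η x⟫‖ ≤ ‖u t x‖ * ‖Δ η x‖ := norm_inner_le_norm _ _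
        _ ≤ M * K₂ := mul_le_mul hx (hK₂ x) (norm_nonneg _) ((norm_nonneg _).trans hx)
        _ = K₂ * M := mul_comm _ _
  have h2 : ∀ x, ‖p t x * VectorCalculus.divergence η x‖ ≤ 3 * K₁ * |p t x| := fun x => by
    rw [norm_mul, Real.norm_eq_abs, mul_comm (3 * K₁)]
    exact mul_le_mul_of_nonneg_left (hdivb x) (abs_nonneg _)
  -- integrability of the two pieces on the ball
  haveI : IsFiniteMeasure ((volume : Measure ℝ³).restrict (ball z.2 R)) :=
    ⟨by rw [Measure.restrict_apply_univ]; exact measure_ball_lt_top⟩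
  have cD : Continuous (fderiv ℝ η) := hη2.continuous_fderiv (by simp)
  have iq : Integrable (fun x => ⟪u t x, fderiv ℝ η x (u t x)⟫ + ⟪u t x, Δ η x⟫)
      (volume.restrict (ball z.2 R)) := by
    have hm : AEStronglyMeasurable (fun x => ⟪u t x, fderiv ℝ η x (u t x)⟫ + ⟪u t x, Δ η x⟫)
        (volume.restrict (ball z.2 R)) :=
      (hut'.1.inner (isBoundedBilinearMap_apply.continuous.comp_aestronglyMeasurable
        (cD.aestronglyMeasurable.prodMk hut'.1))).add
        (hut'.1.inner (continuous_laplacian hη2).aestronglyMeasurable)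
    exact Integrable.mono' (integrable_const _) hm h1
  have ipd : Integrable (fun x => p t x * VectorCalculus.divergence η x)
      (volume.restrict (ball z.2 R)) := by
    have : (fun x => p t x * VectorCalculus.divergence η x) =
        fun x => VectorCalculus.divergence η x * p t x := by ext x; ring
    rw [this]
    exact hpt'.bdd_mul (continuous_divergence cD).aestronglyMeasurable
      (Eventually.of_forall fun x => hdivb x)
  -- assemble
  rw [integral_add iq ipd]
  refine (abs_add_le _ _).trans (add_le_add ?_ ?_)
  · have h := norm_integral_le_of_norm_le_const h1
    rw [measureReal_restrict_apply_univ, measureReal_def, Real.norm_eq_abs] at h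
    linarith [h]
  · calc |∫ x in ball z.2 R, p t x * VectorCalculus.divergence η x|
        ≤ ∫ x in ball z.2 R, ‖p t x * VectorCalculus.divergence η x‖ := by
          rw [← Real.norm_eq_abs]; exact norm_integral_le_integral_norm _
      _ ≤ ∫ x in ball z.2 R, 3 * K₁ * |p t x| :=
          integral_mono ipd.norm (hpt'.abs.const_mul _) h2
      _ = 3 * K₁ * ∫ x in ball z.2 R, |p t x| := MeasureTheory.integral_const_mul _ _

/-! ### The pressure clock and the increment bound -/

/-- The ball slices `∫_B |p(s)|` of an integrable pressure are integrable in time. [folklore] -/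
theorem integrableOn_pressureSlice
    (hpi : IntegrableOn (uncurry p) (parabolicCylinderCentered R z) volume) :
    IntegrableOn (fun s => ∫ x in ball z.2 R, |p s x|) (Ioo (z.1 - R ^ 2) (z.1 + R ^ 2)) := by
  rw [IntegrableOn, volume_restrict_parabolicCylinderCentered] at hpi
  exact hpi.integral_norm_prod_left

/-- The integrand `1 + ∫_B |p(s)|` of the pressure clock is integrable on the closed time
window. [folklore] -/
theorem integrableOn_one_add_pressureSlice
    (hpi : IntegrableOn (uncurry p) (parabolicCylinderCentered R z) volume) :
    IntegrableOn (fun s => 1 + ∫ x in ball z.2 R, |p s x|) (Icc (z.1 - R ^ 2) (z.1 + R ^ 2)) := by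
  refine (integrableOn_Icc_iff_integrableOn_Ioo (by simp) (by simp)).2 ?_
  exact (integrableOn_const (by simp) (by simp)).add (integrableOn_pressureSlice hpi)

/-- **The pressure clock is continuous**: `t ↦ ∫_{]a,t]} (1 + ∫_B |p|)` is continuous on the
closed time window `[a, b]`. [folklore] -/
theorem continuousOn_pressureClock
    (hpi : IntegrableOn (uncurry p) (parabolicCylinderCentered R z) volume) :
    ContinuousOn (fun t => ∫ s in Ioc (z.1 - R ^ 2) t, (1 + ∫ x in ball z.2 R, |p s x|))
      (Icc (z.1 - R ^ 2) (z.1 + R ^ 2)) :=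
  intervalIntegral.continuousOn_primitive (integrableOn_one_add_pressureSlice hpi)

/-- **The increment bound.** With `A₀ = |B| (K₁ M² + K₂ M)` and the pressure clock
`P(t) = ∫_{]a,t]} (1 + ∫_B |p|)`: for `t, t'` in the closed time window,
`|∫_{]a,t]} f_η - ∫_{]a,t']} f_η| ≤ (|A₀| + 3 |K₁|) |P(t) - P(t')|`, where `f_η` is the remainder
of `ae_abs_remainder_le`. [folklore] -/
theorem abs_primitive_sub_primitive_le
    (hsol : IsDistributionalNSSolutionOn (parabolicCylinderCenteredOpens R z) 1 0 u p)
    (hbd : ∀ᵐ w ∂(volume.restrict (parabolicCylinderCentered R z)), ‖u w.1 w.2‖ ≤ M)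
    (hpi : IntegrableOn (uncurry p) (parabolicCylinderCentered R z) volume)
    {η : ℝ³ → ℝ³} (hη : FunctionSpaces.IsTestFunctionOn ⟨ball z.2 R, isOpen_ball⟩ η)
    {K₁ K₂ : ℝ} (hK₁ : ∀ x, ‖fderiv ℝ η x‖ ≤ K₁) (hK₂ : ∀ x, ‖Δ η x‖ ≤ K₂)
    {t t' : ℝ} (ht : t ∈ Icc (z.1 - R ^ 2) (z.1 + R ^ 2)) (ht' : t' ∈ Icc (z.1 - R ^ 2) (z.1 + R ^ 2)) :
    |(∫ s in Ioc (z.1 - R ^ 2) t, ∫ x in ball z.2 R, (⟪u s x, fderiv ℝ η x (u s x)⟫ +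
        ⟪u s x, Δ η x⟫ + p s x * VectorCalculus.divergence η x)) -
      ∫ s in Ioc (z.1 - R ^ 2) t', ∫ x in ball z.2 R, (⟪u s x, fderiv ℝ η x (u s x)⟫ +
        ⟪u s x, Δ η x⟫ + p s x * VectorCalculus.divergence η x)| ≤
      (|(volume (ball z.2 R)).toReal * (K₁ * M ^ 2 + K₂ * M)| + 3 * |K₁|) *
        |(∫ s in Ioc (z.1 - R ^ 2) t, (1 + ∫ x in ball z.2 R, |p s x|)) -
          ∫ s in Ioc (z.1 - R ^ 2) t', (1 + ∫ x in ball z.2 R, |p s x|)| := by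
  set a : ℝ := z.1 - R ^ 2 with ha
  set b : ℝ := z.1 + R ^ 2 with hb
  set A₀ : ℝ := (volume (ball z.2 R)).toReal * (K₁ * M ^ 2 + K₂ * M) with hA₀
  set F : ℝ → ℝ := fun s => ∫ x in ball z.2 R, (⟪u s x, fderiv ℝ η x (u s x)⟫ +
    ⟪u s x, Δ η x⟫ + p s x * VectorCalculus.divergence η x) with hF
  set q : ℝ → ℝ := fun s => ∫ x in ball z.2 R, |p s x| with hq
  set g : ℝ → ℝ := fun s => (|A₀| + 3 * |K₁|) * (1 + q s) with hg
  obtain ⟨K₀, K₁', K₂', hK₀, -, -⟩ := exists_bounds_of_isTestFunctionOn hη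
  have hη2 : ContDiff ℝ 2 η := hη.contDiff.of_le (by norm_cast)
  -- integrability on the closed window
  have hFi : IntegrableOn F (Icc a b) := by
    have iG := integrable_remainder_test hsol hbd hpi hη2 hK₁ hK₂
    rw [volume_restrict_parabolicCylinderCentered] at iG
    exact (integrableOn_Icc_iff_integrableOn_Ioo (by simp) (by simp)).2 iG.integral_prod_left
  have hmi : IntegrableOn (fun s => 1 + q s) (Icc a b) := integrableOn_one_add_pressureSlice hpi
  have hgi : IntegrableOn g (Icc a b) := hmi.const_mul _
  have hII : ∀ {f : ℝ → ℝ}, IntegrableOn f (Icc a b) → ∀ x ∈ Icc a b, ∀ y ∈ Icc a b,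
      IntervalIntegrable f volume x y := fun hf x hx y hy =>
    (hf.mono_set (uIcc_subset_Icc hx hy)).intervalIntegrable
  -- the a.e. bound `|F| ≤ g` on the closed window
  have hq0 : ∀ s, 0 ≤ q s := fun s => integral_nonneg fun x => abs_nonneg _
  have hFg : ∀ᵐ s ∂(volume.restrict (Icc a b)), ‖F s‖ ≤ g s := by
    rw [← Measure.restrict_congr_set (Ioo_ae_eq_Icc (μ := volume) (a := a) (b := b))]
    filter_upwards [ae_abs_remainder_le hsol hbd hpi hη2 hK₁ hK₂] with s hs
    rw [Real.norm_eq_abs, hg]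
    have h1 : A₀ ≤ |A₀| := le_abs_self _
    have h2 : 3 * K₁ * q s ≤ 3 * |K₁| * q s :=
      mul_le_mul_of_nonneg_right (by linarith [le_abs_self K₁]) (hq0 s)
    have h3 : 0 ≤ |A₀| * q s := mul_nonneg (abs_nonneg _) (hq0 s)
    have h4 : 0 ≤ |K₁| := abs_nonneg _
    have hs' : |F s| ≤ A₀ + 3 * K₁ * q s := hs
    nlinarith
  -- reduce to interval integrals
  have hsub : (∫ s in Ioc a t, F s) - ∫ s in Ioc a t', F s = ∫ s in t'..t, F s := by
    rw [← intervalIntegral.integral_of_le ht.1, ← intervalIntegral.integral_of_le ht'.1,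
      intervalIntegral.integral_interval_sub_left (hII hFi a (left_mem_Icc.2 (ht.1.trans ht.2)) t ht)
        (hII hFi a (left_mem_Icc.2 (ht.1.trans ht.2)) t' ht')]
  have hsubP : (∫ s in Ioc a t, (1 + q s)) - ∫ s in Ioc a t', (1 + q s) = ∫ s in t'..t, (1 + q s) := by
    rw [← intervalIntegral.integral_of_le ht.1, ← intervalIntegral.integral_of_le ht'.1,
      intervalIntegral.integral_interval_sub_left (hII hmi a (left_mem_Icc.2 (ht.1.trans ht.2)) t ht)
        (hII hmi a (left_mem_Icc.2 (ht.1.trans ht.2)) t' ht')]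
  rw [hsub, hsubP, ← Real.norm_eq_abs]
  have hFg' : ∀ᵐ s ∂(volume.restrict (uIoc t' t)), ‖F s‖ ≤ g s :=
    ae_restrict_of_ae_restrict_of_subset (uIoc_subset_uIcc.trans (uIcc_subset_Icc ht' ht)) hFg
  -- `‖∫ₐᵇ F‖ ≤ |∫ₐᵇ g|` from `‖F‖ ≤ g` a.e. on `Ι t' t`
  -- (Mathlib `intervalIntegral.norm_integral_le_abs_of_norm_le`).
  refine (intervalIntegral.norm_integral_le_abs_of_norm_le hFg' (hII hgi t' ht' t ht)).trans_eq ?_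
  rw [hg, intervalIntegral.integral_const_mul, abs_mul, abs_of_nonneg (by positivity)]

end Literature.Analysis.FluidPDE
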